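import Summits.ValiantsHypothesis.ValiantsHypothesis.Theorems.BarrierLeverChowBenchmarkPairsHaarCycle

/-!
# Route BarrierLever — item 22038 `ChowBenchmarkPairs`, line `moore-peel`: CONJECTURE HAAR for CYCLES THROUGH THE ORIGIN
# (the 2-regular sub-families of the line's rows containing point rows: `{v_1}, {v_1,v_2}, …, {v_{m−2},v_{m−1}}, {v_{m−1}}`)

Helper file (`--supports stmt-ValiantsHypothesis-22038`; cell valiant-natproofs, rung V4; seat val-np-p4 gen 23).  Closes NO item.

Companion of `…HaarCycle.haar_cycle`.  A point row `{a}` of the line is the segment `[0, P_a]` = the edge `{origin, a}`; a cycle THROUGH the origin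
`0 – v_1 – … – v_{m−1} – 0` is the row family `{v_1}, {v_1,v_2}, …, {v_{m−2}, v_{m−1}}, {v_{m−1}}` (`m` rows).  We index it by `v : Fin m → Fin h` as in
`haar_cycle` and ERASE `v 0` from every edge (`oEdge v t = (cycEdge v t).erase (v 0)`; the position of `v 0` is immaterial).  **`haar_cycle_origin`**: for
`m ≥ 4`, `m ≤ 2^h`, `v` injective, some table makes «these `m` rows × the first `m` codes» nonsingular.  Derivation as in `haar_cycle`: one pure split at bit `0`
with `I = {v_1, …, v_{⌊m/2⌋−1}}`; touching = the path `{v_1}, {v_1 v_2}, …` on the odd codes (weight raised at `v_{max(i,1)}`); inside = the path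
`{v_{m−1}}, {v_{m−2} v_{m−1}}, …` (in this order, so that every row has a fresh point) on the even codes; both by `psr_chain`; transport by permutations.

WHAT THIS IS NOT: no stub of the line is closed; nothing on crux stmt-ValiantsHypothesis-14610 or on `VP` versus `VNP`.
-/

set_option linter.dupNamespace false

namespace Summit.ValiantsHypothesis.ValiantsHypothesis.Theorems.BarrierLever.ChowBenchmarkHaar

open Finset
open Summit.ValiantsHypothesis.ValiantsHypothesis.Theorems.BarrierLever.MoorePeel (benchCols)
open Summit.ValiantsHypothesis.ValiantsHypothesis.Theorems.BarrierLever.ChowBenchmarkPeel (segE)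
open Summit.ValiantsHypothesis.ValiantsHypothesis.Theorems.BarrierLever.ChowBenchmarkSplit
  (dirE dirE_one PSr psr_chain exists_table_of_psr)

section OriginCycle

variable {h m : ℕ}

/-- Edge `t` of the cycle through the origin: `{v_t, v_{t+1 mod m}}` with `v 0` (playing the origin) erased. -/
def oEdge (v : Fin m → Fin h) (hm0 : 0 < m) (t : ℕ) : Finset (Fin h) := (cycEdge v hm0 t).erase (v ⟨0, hm0⟩)

/-- Membership in an origin-cycle edge. -/
theorem mem_oEdge (v : Fin m → Fin h) (hm0 : 0 < m) (t : ℕ) (p : Fin h) :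
    p ∈ oEdge v hm0 t ↔ p ≠ v ⟨0, hm0⟩ ∧ (p = vx v hm0 t ∨ p = vx v hm0 (t + 1)) := by
  simp [oEdge, cycEdge]

/-- `vx 0` is `v 0`. -/
theorem vx_zero (v : Fin m → Fin h) (hm0 : 0 < m) : vx v hm0 0 = v ⟨0, hm0⟩ := by
  simp [vx]

/-- A vertex with index in `(0, m)` is not the origin vertex. -/
theorem vx_ne_origin (v : Fin m → Fin h) (hm0 : 0 < m) (hv : Function.Injective v) {t : ℕ} (ht0 : 0 < t) (ht : t < m) :
    vx v hm0 t ≠ v ⟨0, hm0⟩ := by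
  rw [← vx_zero v hm0]
  intro e
  have := vx_inj v hm0 hv ht hm0 e
  omega

/-- **HAAR FOR CYCLES THROUGH THE ORIGIN.** -/
theorem haar_cycle_origin (hm : 4 ≤ m) (hmh : m ≤ 2 ^ h) (h0 : 0 < h) (v : Fin m → Fin h) (hv : Function.Injective v) :
    ∃ P : Fin h → Fin h → ℂ,
      (Matrix.of fun t j : Fin m => segE P (oEdge v (by omega) t.val) (benchCols h m j)).det ≠ 0 := by
  classical
  have hm0 : 0 < m := by omega
  set a := m - m / 2 with ha
  set b := m / 2 with hb
  have hab : a + b = m := by omega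
  have hb2 : 2 ≤ b := by omega
  have ha2 : 2 ≤ a := by omega
  let c0 : Fin h := ⟨0, h0⟩
  let I : Finset (Fin h) := (Finset.univ.filter fun t : Fin m => 1 ≤ t.val ∧ t.val ≤ b - 1).image v
  let S₁ : Fin a → Finset (Fin h) := fun i => oEdge v hm0 (m - 1 - i.val)
  let S₂ : Fin b → Finset (Fin h) := fun i => oEdge v hm0 i.val
  let T₁ : Fin a → Finset (Fin h) := fun i => benchCols h m (evenCode m i)
  let T₂ : Fin b → Finset (Fin h) := fun i => (benchCols h m (oddCode m i)).erase c0
  let y : Fin b → Fin h := fun i => vx v hm0 (max i.val 1)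
  let w1a : Fin a → Fin h → ℕ := fun _ _ => 1
  let w1b : Fin b → Fin h → ℕ := fun _ _ => 1
  have memI : ∀ t : ℕ, t < m → (vx v hm0 t ∈ I ↔ 1 ≤ t ∧ t ≤ b - 1) := by
    intro t ht
    rw [vx_of_lt v hm0 ht]
    constructor
    · intro hmem
      obtain ⟨s, hs, e⟩ := Finset.mem_image.mp hmem
      have hs' := (Finset.mem_filter.mp hs).2
      have hst : s = ⟨t, ht⟩ := hv e
      subst hst
      exact hs'
    · intro ⟨h1, h2⟩
      exact Finset.mem_image.mpr ⟨⟨t, ht⟩, Finset.mem_filter.mpr ⟨Finset.mem_univ _, h1, h2⟩, rfl⟩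
  -- (1) the INSIDE chain: rows {v_{m-1}}, {v_{m-2}, v_{m-1}}, …, fresh point v_{m-1-i}
  have hin : PSr S₁ w1a T₁ := by
    refine psr_chain a S₁ w1a T₁ (fun i => vx v hm0 (m - 1 - i.val)) ?_ ?_ (fun _ => le_refl 1) ?_
    · intro i
      have hi := i.2
      rw [show S₁ i = oEdge v hm0 (m - 1 - i.val) from rfl, mem_oEdge]
      exact ⟨vx_ne_origin v hm0 hv (by omega) (by omega), Or.inl rfl⟩
    · intro s i hsi hmem
      have hs := s.2
      have hi := i.2
      have hsi' : s.val < i.val := hsi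
      rw [show S₁ s = oEdge v hm0 (m - 1 - s.val) from rfl, mem_oEdge] at hmem
      rcases hmem.2 with e | e
      · have := vx_inj v hm0 hv (by omega) (by omega) e; omega
      · by_cases hs0 : s.val = 0
        · -- the second vertex of edge m-1 is v_m = v_0, erased
          apply hmem.1
          rw [e, show m - 1 - s.val + 1 = m by omega, vx_mod_self, vx_zero]
        · have := vx_inj v hm0 hv (by omega) (by omega) e; omega
    · intro s i hsi
      exact benchCols_not_subset_of_lt hmh (evenCode m s) (evenCode m i)
        (by show (evenCode m s).val < (evenCode m i).val; simp only [evenCode]; have : s.val < i.val := hsi; omega)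
  -- (2) the TOUCHING chain: rows {v_1}, {v_1,v_2}, …, fresh point v_{i+1}, weight raised at y i
  have htouch : PSr S₂ (fun i => Function.update (w1b i) (y i) (w1b i (y i) + 1)) T₂ := by
    refine psr_chain b S₂ _ T₂ (fun i => vx v hm0 (i.val + 1)) ?_ ?_ ?_ ?_
    · intro i
      have hi := i.2
      rw [show S₂ i = oEdge v hm0 i.val from rfl, mem_oEdge]
      exact ⟨vx_ne_origin v hm0 hv (by omega) (by omega), Or.inr rfl⟩
    · intro s i hsi hmem
      have hsi' : s.val < i.val := hsi
      have hs := s.2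
      have hi := i.2
      rw [show S₂ s = oEdge v hm0 s.val from rfl, mem_oEdge] at hmem
      rcases hmem.2 with e | e
      · have := vx_inj v hm0 hv (by omega) (by omega) e; omega
      · have := vx_inj v hm0 hv (by omega) (by omega) e; omega
    · intro i
      by_cases e : vx v hm0 (i.val + 1) = y i
      · rw [e, Function.update_self]; exact Nat.le_add_left 1 _
      · rw [Function.update_of_ne e]
    · intro s i hsi hsub
      apply benchCols_not_subset_of_lt hmh (oddCode m s) (oddCode m i)
        (by show (oddCode m s).val < (oddCode m i).val; simp only [oddCode]; have : s.val < i.val := hsi; omega)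
      intro c hc
      by_cases hc0 : c = c0
      · rw [hc0]; exact zero_mem_benchCols_odd h0 s
      · exact Finset.mem_of_mem_erase (hsub (Finset.mem_erase.mpr ⟨hc0, hc⟩))
  -- (3) the split hypotheses
  have hS₁ : ∀ i : Fin a, ∀ p ∈ S₁ i, p ∉ I := by
    intro i p hp
    have hi := i.2
    rw [show S₁ i = oEdge v hm0 (m - 1 - i.val) from rfl, mem_oEdge] at hp
    rcases hp.2 with e | e
    · rw [e, memI _ (by omega)]; omega
    · by_cases hi0 : i.val = 0
      · exfalso; apply hp.1; rw [e, show m - 1 - i.val + 1 = m by omega, vx_mod_self, vx_zero]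
      · rw [e, memI _ (by omega)]; omega
  have hyS : ∀ i : Fin b, y i ∈ S₂ i := by
    intro i
    have hi := i.2
    rw [show S₂ i = oEdge v hm0 i.val from rfl, mem_oEdge]
    refine ⟨vx_ne_origin v hm0 hv (by simp) (by omega), ?_⟩
    by_cases hi0 : i.val = 0
    · right; show vx v hm0 (max i.val 1) = vx v hm0 (i.val + 1); congr 1; omega
    · left; show vx v hm0 (max i.val 1) = vx v hm0 i.val; congr 1; omega
  have hyI : ∀ i : Fin b, y i ∈ I := by
    intro i
    have hi := i.2
    show vx v hm0 (max i.val 1) ∈ I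
    rw [memI _ (by omega)]; omega
  have hdom : ∀ i : Fin b, ∀ p ∈ S₂ i, p ∈ I → p ≠ y i → rk v (y i) < rk v p := by
    intro i p hp hpI hne
    have hi := i.2
    rw [show S₂ i = oEdge v hm0 i.val from rfl, mem_oEdge] at hp
    by_cases hi0 : i.val = 0
    · exfalso
      rcases hp.2 with e | e
      · apply hp.1; rw [e, hi0, vx_zero]
      · apply hne; rw [e]; show vx v hm0 (i.val + 1) = vx v hm0 (max i.val 1); congr 1; omega
    · have hmax : max i.val 1 = i.val := by omega
      have hy : y i = vx v hm0 i.val := by show vx v hm0 (max i.val 1) = vx v hm0 i.val; rw [hmax]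
      rcases hp.2 with e | e
      · exact absurd (e.trans hy.symm) hne
      · rw [e, hy, vx_of_lt v hm0 (by omega), vx_of_lt v hm0 (by omega), rk_v v hv, rk_v v hv]
        show i.val < i.val + 1
        omega
  have hsplit : PSr (Sum.elim S₁ S₂) (Sum.elim w1a w1b) (Sum.elim T₁ (fun j => insert c0 (T₂ j))) :=
    PSr.split c0 I (rk v) y hin htouch
      (fun j => zero_not_mem_benchCols_even h0 j) (fun j => Finset.notMem_erase c0 _)
      hS₁ hyS hyI hdom (fun _ => le_refl 1)
  -- (4) the glued family is nonsingular at some table; transport to the cycle matrix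
  obtain ⟨P, hP⟩ := exists_table_of_psr hsplit
  refine ⟨P, ?_⟩
  let σ : Fin m → Fin a ⊕ Fin b := fun t => if ht : t.val < b then Sum.inr ⟨t.val, ht⟩ else Sum.inl ⟨m - 1 - t.val, by have := t.2; omega⟩
  let τ : Fin m → Fin a ⊕ Fin b := fun j =>
    if hj : j.val % 2 = 0 then Sum.inl ⟨j.val / 2, by omega⟩ else Sum.inr ⟨j.val / 2, by omega⟩
  have hσ : Function.Bijective σ := by
    refine (Fintype.bijective_iff_injective_and_card σ).mpr ⟨?_, by simp [hab]⟩
    intro s t e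
    by_cases hs : s.val < b <;> by_cases ht : t.val < b
    · simp only [σ, dif_pos hs, dif_pos ht, Sum.inr.injEq, Fin.mk.injEq] at e; exact Fin.ext e
    · simp only [σ, dif_pos hs, dif_neg ht] at e; exact absurd e (by simp)
    · simp only [σ, dif_neg hs, dif_pos ht] at e; exact absurd e (by simp)
    · simp only [σ, dif_neg hs, dif_neg ht, Sum.inl.injEq, Fin.mk.injEq] at e; apply Fin.ext; have := s.2; have := t.2; omega
  have hτ : Function.Bijective τ := by
    refine (Fintype.bijective_iff_injective_and_card τ).mpr ⟨?_, by simp [hab]⟩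
    intro s t e
    by_cases hs : s.val % 2 = 0 <;> by_cases ht : t.val % 2 = 0
    · simp only [τ, dif_pos hs, dif_pos ht, Sum.inl.injEq, Fin.mk.injEq] at e; apply Fin.ext; omega
    · simp only [τ, dif_pos hs, dif_neg ht] at e; exact absurd e (by simp)
    · simp only [τ, dif_neg hs, dif_pos ht] at e; exact absurd e (by simp)
    · simp only [τ, dif_neg hs, dif_neg ht, Sum.inr.injEq, Fin.mk.injEq] at e; apply Fin.ext; omega
  let eσ : Fin m ≃ Fin a ⊕ Fin b := Equiv.ofBijective σ hσ
  let eτ : Fin m ≃ Fin a ⊕ Fin b := Equiv.ofBijective τ hτ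
  set N : Matrix (Fin a ⊕ Fin b) (Fin a ⊕ Fin b) ℂ := Matrix.of fun x x' =>
    dirE P (Sum.elim S₁ S₂ x) (Sum.elim w1a w1b x) (Sum.elim T₁ (fun j => insert c0 (T₂ j)) x') with hN
  have hrow : ∀ t : Fin m, Sum.elim S₁ S₂ (eσ t) = oEdge v hm0 t.val := by
    intro t
    show Sum.elim S₁ S₂ (σ t) = _
    by_cases ht : t.val < b
    · simp only [σ, dif_pos ht, Sum.elim_inr, S₂]
    · simp only [σ, dif_neg ht, Sum.elim_inl, S₁]
      congr 1
      have := t.2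
      omega
  have hwt : ∀ t : Fin m, Sum.elim w1a w1b (eσ t) = fun _ => 1 := by
    intro t
    show Sum.elim w1a w1b (σ t) = _
    by_cases ht : t.val < b
    · simp only [σ, dif_pos ht, Sum.elim_inr, w1b]
    · simp only [σ, dif_neg ht, Sum.elim_inl, w1a]
  have hcol : ∀ j : Fin m, Sum.elim T₁ (fun j => insert c0 (T₂ j)) (eτ j) = benchCols h m j := by
    intro j
    show Sum.elim T₁ (fun j => insert c0 (T₂ j)) (τ j) = _
    by_cases hj : j.val % 2 = 0
    · simp only [τ, dif_pos hj, Sum.elim_inl, T₁]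
      congr 1
      apply Fin.ext
      simp only [evenCode]
      omega
    · simp only [τ, dif_neg hj, Sum.elim_inr, T₂]
      rw [Finset.insert_erase (zero_mem_benchCols_odd h0 _)]
      congr 1
      apply Fin.ext
      simp only [oddCode]
      omega
  have hM : (Matrix.of fun t j : Fin m => segE P (oEdge v hm0 t.val) (benchCols h m j)) =
      (N.submatrix eσ eσ).submatrix id (eτ.trans eσ.symm) := by
    refine Matrix.ext fun t j => ?_
    rw [Matrix.submatrix_apply, Matrix.submatrix_apply, Matrix.of_apply, hN, Matrix.of_apply, id,
      Equiv.trans_apply, Equiv.apply_symm_apply, hrow, hwt, hcol, dirE_one]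
  rw [hM, Matrix.det_permute', Matrix.det_submatrix_equiv_self]
  refine mul_ne_zero ?_ hP
  exact_mod_cast (Equiv.Perm.sign (eτ.trans eσ.symm)).ne_zero


end OriginCycle

end Summit.ValiantsHypothesis.ValiantsHypothesis.Theorems.BarrierLever.ChowBenchmarkHaar
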